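import Literature.Topology.FourManifolds.Bordism
import Literature.Topology.FourManifolds.CylinderCobordism
import HarnessLib

/-!
# Disjoint unions of bordisms (proofs for `Bordism.lean`)

Trunk T-4MAN (`FourManifolds`).  Discharge of the named fact
`Literature.Topology.FourManifolds.ClosedSingularManifold.IsBordant.sum` stated in `Literature/Topology/FourManifolds/Bordism.lean`:

* `Literature.ClosedSingularManifold.IsBordant.sum_holds : IsBordant.sum` — if `(M₁, f₁) ∼ (N₁, g₁)` via a
  bordism `(W₁, F₁)` and `(M₂, f₂) ∼ (N₂, g₂)` via `(W₂, F₂)`, then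
  `(M₁ ⊔ M₂, f₁ ⊔ f₂) ∼ (N₁ ⊔ N₂, g₁ ⊔ g₂)` via `(W₁ ⊔ W₂, F₁ ⊔ F₂)`.
  Milnor–Stasheff, *Characteristic classes* (Ann. of Math. Studies 76, 1974), §17, p. 199 ff.:
  the bordism classes of closed singular manifolds on `X` form the group `𝔑ₙ(X)` under disjoint
  union (this is the well-definedness of `+`); Thom, Comment. Math. Helv. 28 (1954), Ch. IV;
  Atiyah, Proc. Camb. Phil. Soc. 57 (1961), §2.

## Proof

The total space is the disjoint union `W₁ ⊕ W₂` with Mathlib's charted-space and `C^∞` structures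
(`ChartedSpace.sum`, `IsManifold.disjointUnion`); its boundary is `∂W₁ ⊔ ∂W₂`
(`ModelWithCorners.boundary_disjointUnion`), which is the union of the ranges of
`Sum.map inl₁ inl₂` and `Sum.map inr₁ inr₂`.  What Mathlib (v4.32) lacks is that `Sum.map` of two
smooth embeddings is a smooth embedding (it has `IsSmoothEmbedding.sumInl/sumInr/prodMap`, but
neither `comp` nor `sumMap`).  We prove it from the chart-level definition of immersions:

* `IsManifold.lift_openEmbedding_inl_mem_maximalAtlas` (and `inr`): a chart of the maximal `C^n`
  atlas of `M`, lifted along `Sum.inl` (`OpenPartialHomeomorph.lift_openEmbedding`), lies in the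
  maximal atlas of `M ⊕ M'` (same transition maps, or empty ones);
* `Manifold.IsImmersionAtOfComplement.sumMap_inl/_inr`, `Manifold.IsImmersionOfComplement.sumMap`:
  in the lifted charts of an immersion `f` at `x`, `Sum.map f g` again reads `u ↦ equiv (u, 0)`;
* `Manifold.IsImmersion.sumMap`: Mathlib's `IsImmersion` requires one *global* complement; for
  finite-dimensional models the complements `F₁`, `F₂` of `f`, `g` satisfy
  `dim E + dim Fᵢ = dim E''`, hence `F₁ ≃L F₂` (`ContinuousLinearEquiv.ofFinrankEq`), and empty
  summands contribute no points;
* `Topology.IsInducing.sumMap`, `Topology.IsEmbedding.sumMap` (neighbourhood filters of `inl x`,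
  `inr z` in a sum), whence `Manifold.IsSmoothEmbedding.sumMap`;
* `Literature.Topology.FourManifolds.Cobordism.exists_sum`: the disjoint union of two cobordisms is a cobordism between the
  disjoint unions (total space `W ⊕ W'` up to a diffeomorphism commuting with the boundary
  inclusions), `Literature.Topology.FourManifolds.IsCobordant.sum`, and finally `IsBordant.sum_holds` with the map `F₁ ⊔ F₂`.

The general lemmas are deliberate dot-notation extensions of the Mathlib namespaces `IsManifold`,
`Manifold.*` and `Topology.*` (companions of Mathlib's `prodMap`/`sumInl`/`sumInr` lemmas).
-/

open scoped Manifold ContDiff Topology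
open Set Function

noncomputable section

/-! ### Lifting charts of the maximal atlas to a disjoint union -/

namespace IsManifold

variable {𝕜 : Type*} [NontriviallyNormedField 𝕜]
  {E : Type*} [NormedAddCommGroup E] [NormedSpace 𝕜 E] {H : Type*} [TopologicalSpace H]
  {I : ModelWithCorners 𝕜 E H} {n : WithTop ℕ∞}
  {M M' : Type*} [TopologicalSpace M] [ChartedSpace H M] [TopologicalSpace M'] [ChartedSpace H M']

/-- A chart of the maximal `C^n` atlas of `M`, extended along `Sum.inl : M → M ⊕ M'`
(`OpenPartialHomeomorph.lift_openEmbedding`), belongs to the maximal `C^n` atlas of the disjoint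
union `M ⊕ M'`: its transition maps with the lifted charts of `M` are those of `M`, and with the
lifted charts of `M'` they have empty source (cf. Mathlib `IsManifold.disjointUnion`).
Deliberate dot-notation extension of Mathlib's `IsManifold` namespace. [folklore] -/
theorem lift_openEmbedding_inl_mem_maximalAtlas [Nonempty H] {φ : OpenPartialHomeomorph M H}
    (hφ : φ ∈ maximalAtlas I n M) :
    φ.lift_openEmbedding Topology.IsOpenEmbedding.inl ∈ maximalAtlas I n (M ⊕ M') := by
  rw [mem_maximalAtlas_iff, _root_.mem_maximalAtlas_iff]
  intro e' he'
  obtain (⟨f, hf, rfl⟩ | ⟨f, hf, rfl⟩) := ChartedSpace.mem_atlas_sum he'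
  · rw [φ.lift_openEmbedding_trans f Topology.IsOpenEmbedding.inl,
      f.lift_openEmbedding_trans φ Topology.IsOpenEmbedding.inl]
    exact hφ f hf
  · constructor
    · apply ContDiffGroupoid.mem_of_source_eq_empty
      ext x
      exact ⟨fun ⟨hx₁, hx₂⟩ ↦ by simp_all, fun hx ↦ hx.elim⟩
    · apply ContDiffGroupoid.mem_of_source_eq_empty
      ext x
      exact ⟨fun ⟨hx₁, hx₂⟩ ↦ by simp_all, fun hx ↦ hx.elim⟩

/-- A chart of the maximal `C^n` atlas of `M'`, extended along `Sum.inr : M' → M ⊕ M'`, belongs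
to the maximal `C^n` atlas of `M ⊕ M'` (cf. Mathlib `IsManifold.disjointUnion`).
Deliberate dot-notation extension of Mathlib's `IsManifold` namespace. [folklore] -/
theorem lift_openEmbedding_inr_mem_maximalAtlas [Nonempty H] {φ : OpenPartialHomeomorph M' H}
    (hφ : φ ∈ maximalAtlas I n M') :
    φ.lift_openEmbedding Topology.IsOpenEmbedding.inr ∈ maximalAtlas I n (M ⊕ M') := by
  rw [mem_maximalAtlas_iff, _root_.mem_maximalAtlas_iff]
  intro e' he'
  obtain (⟨f, hf, rfl⟩ | ⟨f, hf, rfl⟩) := ChartedSpace.mem_atlas_sum he'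
  · constructor
    · apply ContDiffGroupoid.mem_of_source_eq_empty
      ext x
      exact ⟨fun ⟨hx₁, hx₂⟩ ↦ by simp_all, fun hx ↦ hx.elim⟩
    · apply ContDiffGroupoid.mem_of_source_eq_empty
      ext x
      exact ⟨fun ⟨hx₁, hx₂⟩ ↦ by simp_all, fun hx ↦ hx.elim⟩
  · rw [φ.lift_openEmbedding_trans f Topology.IsOpenEmbedding.inr,
      f.lift_openEmbedding_trans φ Topology.IsOpenEmbedding.inr]
    exact hφ f hf

end IsManifold

/-! ### `Sum.map` of immersions -/

namespace Manifold

universe u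

variable {𝕜 : Type*} [NontriviallyNormedField 𝕜]
  {E : Type*} [NormedAddCommGroup E] [NormedSpace 𝕜 E] {H : Type*} [TopologicalSpace H]
  {I : ModelWithCorners 𝕜 E H} {n : WithTop ℕ∞}
  {E'' : Type u} [NormedAddCommGroup E''] [NormedSpace 𝕜 E''] {G : Type*} [TopologicalSpace G]
  {J : ModelWithCorners 𝕜 E'' G}
  {F : Type*} [NormedAddCommGroup F] [NormedSpace 𝕜 F]
  {M M' : Type*} [TopologicalSpace M] [ChartedSpace H M] [TopologicalSpace M'] [ChartedSpace H M']
  {N N' : Type*} [TopologicalSpace N] [ChartedSpace G N] [TopologicalSpace N'] [ChartedSpace G N']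
  {f : M → N} {g : M' → N'}

/-- If `f : M → N` is a `C^n` immersion at `x` with complement `F`, then
`Sum.map f g : M ⊕ M' → N ⊕ N'` is a `C^n` immersion at `Sum.inl x` with the same complement: in
the charts of `f` at `x` lifted along `Sum.inl` it again reads `u ↦ equiv (u, 0)`.
Deliberate dot-notation extension of Mathlib's `Manifold.IsImmersionAtOfComplement`. [folklore] -/
theorem IsImmersionAtOfComplement.sumMap_inl {x : M}
    (hf : IsImmersionAtOfComplement F I J n f x) :
    IsImmersionAtOfComplement F I J n (Sum.map f g) (Sum.inl x) := by
  haveI : Nonempty H := nonempty_of_chartedSpace x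
  haveI : Nonempty G := nonempty_of_chartedSpace (f x)
  refine IsImmersionAtOfComplement.mk_of_charts hf.equiv
    (hf.domChart.lift_openEmbedding Topology.IsOpenEmbedding.inl)
    (hf.codChart.lift_openEmbedding Topology.IsOpenEmbedding.inl)
    (mem_image_of_mem _ hf.mem_domChart_source) (mem_image_of_mem _ hf.mem_codChart_source)
    (IsManifold.lift_openEmbedding_inl_mem_maximalAtlas hf.domChart_mem_maximalAtlas)
    (IsManifold.lift_openEmbedding_inl_mem_maximalAtlas hf.codChart_mem_maximalAtlas) ?_ ?_
  · rintro _ ⟨y, hy, rfl⟩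
    exact mem_image_of_mem _ (hf.source_subset_preimage_source hy)
  · intro u hu
    have hu' : u ∈ (hf.domChart.extend I).target := by
      rw [OpenPartialHomeomorph.extend_target] at hu ⊢
      exact hu
    have key := hf.writtenInCharts hu'
    simp only [comp_apply, OpenPartialHomeomorph.extend_coe, OpenPartialHomeomorph.extend_coe_symm,
      OpenPartialHomeomorph.lift_openEmbedding_symm, Sum.map_inl] at key ⊢
    rw [OpenPartialHomeomorph.lift_openEmbedding_apply]
    exact key

/-- If `g : M' → N'` is a `C^n` immersion at `x` with complement `F`, then
`Sum.map f g : M ⊕ M' → N ⊕ N'` is a `C^n` immersion at `Sum.inr x` with the same complement.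
Deliberate dot-notation extension of Mathlib's `Manifold.IsImmersionAtOfComplement`. [folklore] -/
theorem IsImmersionAtOfComplement.sumMap_inr {x : M'}
    (hg : IsImmersionAtOfComplement F I J n g x) :
    IsImmersionAtOfComplement F I J n (Sum.map f g) (Sum.inr x) := by
  haveI : Nonempty H := nonempty_of_chartedSpace x
  haveI : Nonempty G := nonempty_of_chartedSpace (g x)
  refine IsImmersionAtOfComplement.mk_of_charts hg.equiv
    (hg.domChart.lift_openEmbedding Topology.IsOpenEmbedding.inr)
    (hg.codChart.lift_openEmbedding Topology.IsOpenEmbedding.inr)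
    (mem_image_of_mem _ hg.mem_domChart_source) (mem_image_of_mem _ hg.mem_codChart_source)
    (IsManifold.lift_openEmbedding_inr_mem_maximalAtlas hg.domChart_mem_maximalAtlas)
    (IsManifold.lift_openEmbedding_inr_mem_maximalAtlas hg.codChart_mem_maximalAtlas) ?_ ?_
  · rintro _ ⟨y, hy, rfl⟩
    exact mem_image_of_mem _ (hg.source_subset_preimage_source hy)
  · intro u hu
    have hu' : u ∈ (hg.domChart.extend I).target := by
      rw [OpenPartialHomeomorph.extend_target] at hu ⊢
      exact hu
    have key := hg.writtenInCharts hu'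
    simp only [comp_apply, OpenPartialHomeomorph.extend_coe, OpenPartialHomeomorph.extend_coe_symm,
      OpenPartialHomeomorph.lift_openEmbedding_symm, Sum.map_inr] at key ⊢
    rw [OpenPartialHomeomorph.lift_openEmbedding_apply]
    exact key

/-- If `f` and `g` are `C^n` immersions with the same complement `F`, so is `Sum.map f g`.
Deliberate dot-notation extension of Mathlib's `Manifold.IsImmersionOfComplement`
(companion of `IsImmersionOfComplement.prodMap`). [folklore] -/
theorem IsImmersionOfComplement.sumMap (hf : IsImmersionOfComplement F I J n f)
    (hg : IsImmersionOfComplement F I J n g) : IsImmersionOfComplement F I J n (Sum.map f g)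
  | Sum.inl x => (hf x).sumMap_inl
  | Sum.inr x => (hg x).sumMap_inr

/-- The complement `F` of an immersion at a point into a manifold with finite-dimensional model
`E''` is finite-dimensional (`F ↪ E × F ≃ E''`). [folklore] -/
theorem IsImmersionAtOfComplement.finiteDimensional_complement [FiniteDimensional 𝕜 E''] {x : M}
    (hf : IsImmersionAtOfComplement F I J n f x) : FiniteDimensional 𝕜 F :=
  FiniteDimensional.of_injective
    ((hf.equiv : (E × F) ≃L[𝕜] E'').toLinearEquiv.toLinearMap.comp (LinearMap.inr 𝕜 E F))
    (hf.equiv.injective.comp LinearMap.inr_injective)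

/-- For an immersion at a point between manifolds with finite-dimensional models `E`, `E''` and
complement `F`, `dim E + dim F = dim E''` (from the isomorphism `E × F ≃L[𝕜] E''`). [folklore] -/
theorem IsImmersionAtOfComplement.finrank_add_finrank_complement [FiniteDimensional 𝕜 E]
    [FiniteDimensional 𝕜 E''] {x : M} (hf : IsImmersionAtOfComplement F I J n f x) :
    Module.finrank 𝕜 E + Module.finrank 𝕜 F = Module.finrank 𝕜 E'' := by
  haveI := hf.finiteDimensional_complement
  rw [← Module.finrank_prod]
  exact hf.equiv.toLinearEquiv.finrank_eq

/-- **`Sum.map` of immersions is an immersion** (finite-dimensional models, complete field): if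
`f : M → N` and `g : M' → N'` are `C^n` immersions then so is `Sum.map f g : M ⊕ M' → N ⊕ N'`.
Mathlib's `IsImmersion` asks for one *global* complement; the complements of `f` and `g` both have
dimension `dim E'' - dim E` (when `M`, `M'` are nonempty), hence are isomorphic
(`ContinuousLinearEquiv.ofFinrankEq`), and empty summands contribute no points.  (Without
finite-dimensionality the two complements need not be isomorphic.)
Deliberate dot-notation extension of Mathlib's `Manifold.IsImmersion` (companion of
`IsImmersion.prodMap`). [folklore] -/
theorem IsImmersion.sumMap [FiniteDimensional 𝕜 E] [FiniteDimensional 𝕜 E''] [CompleteSpace 𝕜]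
    (hf : IsImmersion I J n f) (hg : IsImmersion I J n g) : IsImmersion I J n (Sum.map f g) := by
  obtain (hM | ⟨⟨x₀⟩⟩) := isEmpty_or_nonempty M
  · refine (IsImmersionOfComplement.isImmersion (F := hg.complement) fun p => ?_)
    obtain (x | x) := p
    · exact (IsEmpty.false x).elim
    · exact (hg.isImmersionOfComplement_complement x).sumMap_inr
  obtain (hM' | ⟨⟨x₀'⟩⟩) := isEmpty_or_nonempty M'
  · refine (IsImmersionOfComplement.isImmersion (F := hf.complement) fun p => ?_)
    obtain (x | x) := p
    · exact (hf.isImmersionOfComplement_complement x).sumMap_inl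
    · exact (IsEmpty.false x).elim
  have h₁ := hf.isImmersionOfComplement_complement x₀
  have h₂ := hg.isImmersionOfComplement_complement x₀'
  haveI := h₁.finiteDimensional_complement
  haveI := h₂.finiteDimensional_complement
  have hrank : Module.finrank 𝕜 hg.complement = Module.finrank 𝕜 hf.complement := by
    have := h₁.finrank_add_finrank_complement
    have := h₂.finrank_add_finrank_complement
    omega
  exact (hf.isImmersionOfComplement_complement.sumMap
    (hg.isImmersionOfComplement_complement.trans_F
      (ContinuousLinearEquiv.ofFinrankEq hrank))).isImmersion

end Manifold

/-! ### `Sum.map` of embeddings -/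

/-- `Sum.map` of two inducing maps is inducing: `𝓝 (inl x) = map inl (𝓝 x)` on both sides and
`(Sum.map f g) ⁻¹' (inl '' t) = inl '' (f ⁻¹' t)`.  Deliberate dot-notation extension of Mathlib's
`Topology.IsInducing` (Mathlib has `IsInducing.prodMap`, `IsOpenEmbedding.sumElim`). [folklore] -/
theorem Topology.IsInducing.sumMap {X Y Z W : Type*} [TopologicalSpace X] [TopologicalSpace Y]
    [TopologicalSpace Z] [TopologicalSpace W] {f : X → Y} {g : Z → W} (hf : Topology.IsInducing f)
    (hg : Topology.IsInducing g) : Topology.IsInducing (Sum.map f g) := by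
  rw [Topology.isInducing_iff_nhds]
  rintro (x | z)
  · rw [Sum.map_inl, nhds_inl, nhds_inl, hf.nhds_eq_comap]
    ext s
    simp only [Filter.mem_map, Filter.mem_comap]
    constructor
    · rintro ⟨t, ht, hts⟩
      refine ⟨Sum.inl '' t, by rwa [preimage_image_eq _ Sum.inl_injective], ?_⟩
      rintro (a | b) hab
      · simp only [mem_preimage, Sum.map_inl, Sum.inl_injective.mem_set_image] at hab
        exact hts hab
      · simp at hab
    · rintro ⟨T, hT, hTs⟩
      exact ⟨Sum.inl ⁻¹' T, hT, fun a ha => hTs (by simpa using ha)⟩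
  · rw [Sum.map_inr, nhds_inr, nhds_inr, hg.nhds_eq_comap]
    ext s
    simp only [Filter.mem_map, Filter.mem_comap]
    constructor
    · rintro ⟨t, ht, hts⟩
      refine ⟨Sum.inr '' t, by rwa [preimage_image_eq _ Sum.inr_injective], ?_⟩
      rintro (a | b) hab
      · simp at hab
      · simp only [mem_preimage, Sum.map_inr, Sum.inr_injective.mem_set_image] at hab
        exact hts hab
    · rintro ⟨T, hT, hTs⟩
      exact ⟨Sum.inr ⁻¹' T, hT, fun a ha => hTs (by simpa using ha)⟩

/-- `Sum.map` of two topological embeddings is a topological embedding.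
Deliberate dot-notation extension of Mathlib's `Topology.IsEmbedding` (Mathlib has
`IsEmbedding.prodMap`). [folklore] -/
theorem Topology.IsEmbedding.sumMap {X Y Z W : Type*} [TopologicalSpace X] [TopologicalSpace Y]
    [TopologicalSpace Z] [TopologicalSpace W] {f : X → Y} {g : Z → W} (hf : Topology.IsEmbedding f)
    (hg : Topology.IsEmbedding g) : Topology.IsEmbedding (Sum.map f g) :=
  ⟨hf.isInducing.sumMap hg.isInducing, Sum.map_injective.2 ⟨hf.injective, hg.injective⟩⟩

namespace Manifold

universe u

variable {𝕜 : Type*} [NontriviallyNormedField 𝕜]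
  {E : Type*} [NormedAddCommGroup E] [NormedSpace 𝕜 E] {H : Type*} [TopologicalSpace H]
  {I : ModelWithCorners 𝕜 E H} {n : WithTop ℕ∞}
  {E'' : Type u} [NormedAddCommGroup E''] [NormedSpace 𝕜 E''] {G : Type*} [TopologicalSpace G]
  {J : ModelWithCorners 𝕜 E'' G}
  {M M' : Type*} [TopologicalSpace M] [ChartedSpace H M] [TopologicalSpace M'] [ChartedSpace H M']
  {N N' : Type*} [TopologicalSpace N] [ChartedSpace G N] [TopologicalSpace N'] [ChartedSpace G N']
  {f : M → N} {g : M' → N'}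

/-- **`Sum.map` of smooth embeddings is a smooth embedding** (finite-dimensional models, complete
field): an immersion by `IsImmersion.sumMap` and a topological embedding by `IsEmbedding.sumMap`.
Deliberate dot-notation extension of Mathlib's `Manifold.IsSmoothEmbedding` (companion of
`IsSmoothEmbedding.prodMap`, `sumInl`, `sumInr`). [folklore] -/
theorem IsSmoothEmbedding.sumMap [FiniteDimensional 𝕜 E] [FiniteDimensional 𝕜 E'']
    [CompleteSpace 𝕜] (hf : IsSmoothEmbedding I J n f) (hg : IsSmoothEmbedding I J n g) :
    IsSmoothEmbedding I J n (Sum.map f g) :=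
  ⟨hf.isImmersion.sumMap hg.isImmersion, hf.isEmbedding.sumMap hg.isEmbedding⟩

end Manifold

/-! ### Disjoint unions of cobordisms and of bordisms -/

namespace Literature.Topology.FourManifolds

universe u

/-- The range of `Sum.map f g` is `inl '' range f ∪ inr '' range g`. [folklore] -/
theorem range_sumMap {α β γ δ : Type*} (f : α → γ) (g : β → δ) :
    range (Sum.map f g) = Sum.inl '' range f ∪ Sum.inr '' range g := by
  rw [show Sum.map f g = Sum.elim (Sum.inl ∘ f) (Sum.inr ∘ g) from rfl, Sum.elim_range,
    range_comp, range_comp]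

section Cobordism

variable {n : ℕ} {M M' N N' : Type u}
  [TopologicalSpace M] [ChartedSpace (EuclideanSpace ℝ (Fin n)) M]
  [TopologicalSpace M'] [ChartedSpace (EuclideanSpace ℝ (Fin n)) M']
  [TopologicalSpace N] [ChartedSpace (EuclideanSpace ℝ (Fin n)) N]
  [TopologicalSpace N'] [ChartedSpace (EuclideanSpace ℝ (Fin n)) N']

/-- The ranges of `Sum.map inl inl'` and `Sum.map inr inr'` are disjoint for two cobordisms.
[folklore] -/
theorem Cobordism.disjoint_range_sumMap (c : Cobordism n M N) (c' : Cobordism n M' N') :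
    Disjoint (range (Sum.map c.inl c'.inl)) (range (Sum.map c.inr c'.inr)) := by
  rw [range_sumMap, range_sumMap, disjoint_union_left, disjoint_union_right,
    disjoint_union_right, disjoint_image_iff Sum.inl_injective,
    disjoint_image_iff Sum.inr_injective]
  exact ⟨⟨c.disjoint_range, isCompl_range_inl_range_inr.disjoint.mono (image_subset_range _ _)
    (image_subset_range _ _)⟩, ⟨isCompl_range_inl_range_inr.disjoint.symm.mono
    (image_subset_range _ _) (image_subset_range _ _), c'.disjoint_range⟩⟩

/-- For two cobordisms `W`, `W'`, the ranges of `Sum.map inl inl'` and `Sum.map inr inr'` cover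
the boundary `∂(W ⊔ W') = ∂W ⊔ ∂W'` (Mathlib `ModelWithCorners.boundary_disjointUnion`).
[folklore] -/
theorem Cobordism.range_sumMap_union_range_sumMap (c : Cobordism n M N) (c' : Cobordism n M' N') :
    range (Sum.map c.inl c'.inl) ∪ range (Sum.map c.inr c'.inr) =
      (𝓡∂ (n + 1)).boundary (c.W ⊕ c'.W) := by
  rw [range_sumMap, range_sumMap, ModelWithCorners.boundary_disjointUnion,
    ← c.range_inl_union_range_inr, ← c'.range_inl_union_range_inr, image_union, image_union]
  ac_rfl

/-- **Disjoint union of cobordisms.**  If `W` is a cobordism from `M` to `N` and `W'` one from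
`M'` to `N'`, there is a cobordism from `M ⊔ M'` to `N ⊔ N'` whose total space is (diffeomorphic,
compatibly with the boundary inclusions `Sum.map inl inl'`, `Sum.map inr inr'`, to) the disjoint
union `W ⊔ W'` with Mathlib's `C^∞` structure `IsManifold.disjointUnion`: the inclusions are smooth
embeddings by `IsSmoothEmbedding.sumMap`, and `∂(W ⊔ W') = ∂W ⊔ ∂W'`.  Milnor–Stasheff,
*Characteristic classes* (1974), §17 (disjoint union as the addition of `𝔑ₙ(X)`); Milnor,
*Lectures on the h-cobordism theorem* (1965), §1. [cite: MilnorStasheff1974, §17] -/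
theorem Cobordism.exists_sum (c : Cobordism n M N) (c' : Cobordism n M' N') :
    ∃ (d : Cobordism n (M ⊕ M') (N ⊕ N'))
      (Φ : d.W ≃ₘ^∞⟮𝓡∂ (n + 1), 𝓡∂ (n + 1)⟯ (c.W ⊕ c'.W)),
      (∀ x, Φ (d.inl x) = Sum.map c.inl c'.inl x) ∧ ∀ y, Φ (d.inr y) = Sum.map c.inr c'.inr y :=
  ⟨{ W := c.W ⊕ c'.W
     inl := Sum.map c.inl c'.inl
     inr := Sum.map c.inr c'.inr
     isSmoothEmbedding_inl := c.isSmoothEmbedding_inl.sumMap c'.isSmoothEmbedding_inl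
     isSmoothEmbedding_inr := c.isSmoothEmbedding_inr.sumMap c'.isSmoothEmbedding_inr
     disjoint_range := c.disjoint_range_sumMap c'
     range_inl_union_range_inr := c.range_sumMap_union_range_sumMap c' },
    Diffeomorph.refl _ _ _, fun _ => rfl, fun _ => rfl⟩

/-- Cobordism is compatible with disjoint union: `M ∼ N` and `M' ∼ N'` imply `M ⊔ M' ∼ N ⊔ N'`
(`Literature.Topology.FourManifolds.Cobordism.exists_sum`).  Milnor–Stasheff (1974), §17; Milnor (1965), §1.
[cite: MilnorStasheff1974, §17] -/
theorem IsCobordant.sum (h : IsCobordant n M N) (h' : IsCobordant n M' N') :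
    IsCobordant n (M ⊕ M') (N ⊕ N') :=
  h.elim fun c => h'.elim fun c' => (c.exists_sum c').elim fun d _ => ⟨d⟩

end Cobordism

namespace ClosedSingularManifold

variable {X : Type*} [TopologicalSpace X] {n : ℕ}

/-- **Bordism is compatible with disjoint union** (discharge of the named fact
`Literature.Topology.FourManifolds.ClosedSingularManifold.IsBordant.sum`): if `(W₁, F₁)` is a bordism from `s` to `s'` and
`(W₂, F₂)` one from `t` to `t'`, then the disjoint-union cobordism `W₁ ⊔ W₂`
(`Literature.Topology.FourManifolds.Cobordism.exists_sum`) with the map `(F₁ ⊔ F₂) ∘ Φ : W → X` is a bordism from `s ⊔ t` to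
`s' ⊔ t'`.  Milnor–Stasheff, *Characteristic classes* (1974), §17 (p. 199 ff.: `𝔑ₙ(X)` is a group
under disjoint union).  [cite: MilnorStasheff1974, §17] -/
theorem IsBordant.sum_holds : IsBordant.sum.{u} (X := X) (n := n) := by
  intro s s' t t' hs ht
  obtain ⟨c₁, F₁, hl₁, hr₁⟩ := hs
  obtain ⟨c₂, F₂, hl₂, hr₂⟩ := ht
  obtain ⟨d, Φ, hΦl, hΦr⟩ := c₁.exists_sum c₂
  refine ⟨d, (⟨Sum.elim F₁ F₂, F₁.continuous.sumElim F₂.continuous⟩ : C(c₁.W ⊕ c₂.W, X)).comp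
    ⟨Φ, Φ.continuous⟩, ?_, ?_⟩
  · rintro (x | x)
    · simp only [ContinuousMap.comp_apply, ContinuousMap.coe_mk]
      rw [hΦl]
      exact hl₁ x
    · simp only [ContinuousMap.comp_apply, ContinuousMap.coe_mk]
      rw [hΦl]
      exact hl₂ x
  · rintro (y | y)
    · simp only [ContinuousMap.comp_apply, ContinuousMap.coe_mk]
      rw [hΦr]
      exact hr₁ y
    · simp only [ContinuousMap.comp_apply, ContinuousMap.coe_mk]
      rw [hΦr]
      exact hr₂ y

end ClosedSingularManifold

end Literature.Topology.FourManifolds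

/-! ## Every bordism class has order two (proofs for `Bordism.lean`, continued)

Discharge of the named fact `Literature.Topology.FourManifolds.ClosedSingularManifold.isBordant_sum_self_empty`
(`Bordism.lean`):

* `Literature.Topology.FourManifolds.ClosedSingularManifold.isBordant_sum_self_empty_holds` — for
  every closed singular `n`-manifold `(M, f)` on `X`, `(M ⊔ M, f ⊔ f)` is bordant to the empty
  singular manifold: `2 [M, f] = 0` in `𝔑ₙ(X)`.  Milnor–Stasheff, *Characteristic classes*
  (Ann. of Math. Studies 76, 1974), §17, p. 199 ff. (every element of `𝔑ₙ(X)` has order `2`,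
  `𝔑ₙ(X)` is a module over `ℤ/2`); Thom, Comment. Math. Helv. 28 (1954), Ch. IV; Conner–Floyd,
  *Differentiable Periodic Maps* (1964), §8 ("every element in this group has order two").
  Proof as printed: `M ⊔ M` is the boundary of the cylinder `M × [0, 1]`, and `f ∘ pr₁` extends
  `f ⊔ f` over it.

### Proof

The cylinder `M × [0, 1]` as a tree `Cobordism n M M` modelled on `𝓡∂ (n + 1)` — the hard part,
re-charting Mathlib's product-with-corners structure — is `Literature.Topology.FourManifolds.cylinderCobordism`
(`CylinderCobordism.lean`; Milnor, *Lectures on the h-cobordism theorem* (1965), §1).  What is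
added here is the re-bracketing of the ends of a cobordism (Milnor 1965, §1: a triad `(W; V₀, V₁)`
is also the triad `(W; V₀ ⊔ V₁, ∅)`):

* `Manifold.IsImmersionAtOfComplement.sumElim_inl/_inr`, `Manifold.IsImmersionOfComplement.sumElim`,
  `Manifold.IsImmersion.sumElim`: for immersions `f : M → N`, `g : M' → N` into the *same*
  manifold, `Sum.elim f g : M ⊕ M' → N` is an immersion (in the charts of `f` at `x` with the
  domain chart lifted along `Sum.inl`, `Sum.elim f g` again reads `u ↦ equiv (u, 0)`; the two
  complements are identified by a dimension count as for `IsImmersion.sumMap`);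
* `Manifold.IsSmoothEmbedding.sumElim`: with compact domains, Hausdorff target and disjoint ranges,
  `Sum.elim f g` is moreover a (closed) topological embedding;
* `Literature.Topology.FourManifolds.Cobordism.exists_fold`: a cobordism from `M` to `N` with
  compact ends yields one from `M ⊔ N` to any empty `P`, with the same total space;
* `isBordant_sum_self_empty_holds`: fold the cylinder cobordism of `s.M` (second countable as a
  compact charted space, `ChartedSpace.secondCountable_of_sigmaCompact`) and extend `f ⊔ f` by
  `f ∘ pr₁ ∘ Φ`.
-/

/-! ### `Sum.elim` of immersions into a common target -/

namespace Manifold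

universe u

variable {𝕜 : Type*} [NontriviallyNormedField 𝕜]
  {E : Type*} [NormedAddCommGroup E] [NormedSpace 𝕜 E] {H : Type*} [TopologicalSpace H]
  {I : ModelWithCorners 𝕜 E H} {n : WithTop ℕ∞}
  {E'' : Type u} [NormedAddCommGroup E''] [NormedSpace 𝕜 E''] {G : Type*} [TopologicalSpace G]
  {J : ModelWithCorners 𝕜 E'' G}
  {F : Type*} [NormedAddCommGroup F] [NormedSpace 𝕜 F]
  {M M' : Type*} [TopologicalSpace M] [ChartedSpace H M] [TopologicalSpace M'] [ChartedSpace H M']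
  {N : Type*} [TopologicalSpace N] [ChartedSpace G N]
  {f : M → N} {g : M' → N}

/-- If `f : M → N` is a `C^n` immersion at `x` with complement `F`, then
`Sum.elim f g : M ⊕ M' → N` is a `C^n` immersion at `Sum.inl x` with the same complement: in the
domain chart of `f` at `x` lifted along `Sum.inl` and the target chart of `f`, it again reads
`u ↦ equiv (u, 0)`.  Deliberate dot-notation extension of Mathlib's
`Manifold.IsImmersionAtOfComplement` (companion of `sumMap_inl`). [folklore] -/
theorem IsImmersionAtOfComplement.sumElim_inl {x : M}
    (hf : IsImmersionAtOfComplement F I J n f x) :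
    IsImmersionAtOfComplement F I J n (Sum.elim f g) (Sum.inl x) := by
  haveI : Nonempty H := nonempty_of_chartedSpace x
  refine IsImmersionAtOfComplement.mk_of_charts hf.equiv
    (hf.domChart.lift_openEmbedding Topology.IsOpenEmbedding.inl) hf.codChart
    (mem_image_of_mem _ hf.mem_domChart_source) hf.mem_codChart_source
    (IsManifold.lift_openEmbedding_inl_mem_maximalAtlas hf.domChart_mem_maximalAtlas)
    hf.codChart_mem_maximalAtlas ?_ ?_
  · rintro _ ⟨y, hy, rfl⟩
    exact hf.source_subset_preimage_source hy
  · intro u hu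
    have hu' : u ∈ (hf.domChart.extend I).target := by
      rw [OpenPartialHomeomorph.extend_target] at hu ⊢
      exact hu
    have key := hf.writtenInCharts hu'
    simp only [comp_apply, OpenPartialHomeomorph.extend_coe, OpenPartialHomeomorph.extend_coe_symm,
      OpenPartialHomeomorph.lift_openEmbedding_symm, Sum.elim_inl] at key ⊢
    exact key

/-- If `g : M' → N` is a `C^n` immersion at `x` with complement `F`, then
`Sum.elim f g : M ⊕ M' → N` is a `C^n` immersion at `Sum.inr x` with the same complement.
Deliberate dot-notation extension of Mathlib's `Manifold.IsImmersionAtOfComplement`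
(companion of `sumMap_inr`). [folklore] -/
theorem IsImmersionAtOfComplement.sumElim_inr {x : M'}
    (hg : IsImmersionAtOfComplement F I J n g x) :
    IsImmersionAtOfComplement F I J n (Sum.elim f g) (Sum.inr x) := by
  haveI : Nonempty H := nonempty_of_chartedSpace x
  refine IsImmersionAtOfComplement.mk_of_charts hg.equiv
    (hg.domChart.lift_openEmbedding Topology.IsOpenEmbedding.inr) hg.codChart
    (mem_image_of_mem _ hg.mem_domChart_source) hg.mem_codChart_source
    (IsManifold.lift_openEmbedding_inr_mem_maximalAtlas hg.domChart_mem_maximalAtlas)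
    hg.codChart_mem_maximalAtlas ?_ ?_
  · rintro _ ⟨y, hy, rfl⟩
    exact hg.source_subset_preimage_source hy
  · intro u hu
    have hu' : u ∈ (hg.domChart.extend I).target := by
      rw [OpenPartialHomeomorph.extend_target] at hu ⊢
      exact hu
    have key := hg.writtenInCharts hu'
    simp only [comp_apply, OpenPartialHomeomorph.extend_coe, OpenPartialHomeomorph.extend_coe_symm,
      OpenPartialHomeomorph.lift_openEmbedding_symm, Sum.elim_inr] at key ⊢
    exact key

/-- If `f : M → N` and `g : M' → N` are `C^n` immersions with the same complement `F`, so is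
`Sum.elim f g : M ⊕ M' → N`.  Deliberate dot-notation extension of Mathlib's
`Manifold.IsImmersionOfComplement` (companion of `sumMap`). [folklore] -/
theorem IsImmersionOfComplement.sumElim (hf : IsImmersionOfComplement F I J n f)
    (hg : IsImmersionOfComplement F I J n g) : IsImmersionOfComplement F I J n (Sum.elim f g)
  | Sum.inl x => (hf x).sumElim_inl
  | Sum.inr x => (hg x).sumElim_inr

/-- **`Sum.elim` of immersions is an immersion** (finite-dimensional models, complete field): if
`f : M → N` and `g : M' → N` are `C^n` immersions then so is `Sum.elim f g : M ⊕ M' → N`.  As for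
`IsImmersion.sumMap`, the complements of `f` and `g` have the same dimension `dim E'' - dim E`
(when `M`, `M'` are nonempty) and are therefore isomorphic; empty summands contribute no points.
Deliberate dot-notation extension of Mathlib's `Manifold.IsImmersion`. [folklore] -/
theorem IsImmersion.sumElim [FiniteDimensional 𝕜 E] [FiniteDimensional 𝕜 E''] [CompleteSpace 𝕜]
    (hf : IsImmersion I J n f) (hg : IsImmersion I J n g) : IsImmersion I J n (Sum.elim f g) := by
  obtain (hM | ⟨⟨x₀⟩⟩) := isEmpty_or_nonempty M
  · refine (IsImmersionOfComplement.isImmersion (F := hg.complement) fun p => ?_)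
    obtain (x | x) := p
    · exact (IsEmpty.false x).elim
    · exact (hg.isImmersionOfComplement_complement x).sumElim_inr
  obtain (hM' | ⟨⟨x₀'⟩⟩) := isEmpty_or_nonempty M'
  · refine (IsImmersionOfComplement.isImmersion (F := hf.complement) fun p => ?_)
    obtain (x | x) := p
    · exact (hf.isImmersionOfComplement_complement x).sumElim_inl
    · exact (IsEmpty.false x).elim
  have h₁ := hf.isImmersionOfComplement_complement x₀
  have h₂ := hg.isImmersionOfComplement_complement x₀'
  haveI := h₁.finiteDimensional_complement
  haveI := h₂.finiteDimensional_complement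
  have hrank : Module.finrank 𝕜 hg.complement = Module.finrank 𝕜 hf.complement := by
    have := h₁.finrank_add_finrank_complement
    have := h₂.finrank_add_finrank_complement
    omega
  exact (hf.isImmersionOfComplement_complement.sumElim
    (hg.isImmersionOfComplement_complement.trans_F
      (ContinuousLinearEquiv.ofFinrankEq hrank))).isImmersion

/-- **`Sum.elim` of smooth embeddings with compact domains and disjoint ranges is a smooth
embedding** (finite-dimensional models, complete field, Hausdorff target): an immersion by
`IsImmersion.sumElim`, and a topological embedding because a continuous injection of the compact
space `M ⊕ M'` into the Hausdorff space `N` is a closed embedding.  (Without compactness,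
disjointness of the ranges does not suffice: glue `(0, 1)` and `[1, 2]` in `ℝ`.)
Deliberate dot-notation extension of Mathlib's `Manifold.IsSmoothEmbedding`. [folklore] -/
theorem IsSmoothEmbedding.sumElim [FiniteDimensional 𝕜 E] [FiniteDimensional 𝕜 E'']
    [CompleteSpace 𝕜] [CompactSpace M] [CompactSpace M'] [T2Space N]
    (hf : IsSmoothEmbedding I J n f) (hg : IsSmoothEmbedding I J n g)
    (hfg : Disjoint (range f) (range g)) : IsSmoothEmbedding I J n (Sum.elim f g) := by
  refine ⟨hf.isImmersion.sumElim hg.isImmersion, Topology.IsClosedEmbedding.isEmbedding ?_⟩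
  refine (hf.isEmbedding.continuous.sumElim hg.isEmbedding.continuous).isClosedEmbedding ?_
  exact hf.isEmbedding.injective.sumElim hg.isEmbedding.injective fun a b hab =>
    hfg.le_bot ⟨mem_range_self a, hab ▸ mem_range_self b⟩

end Manifold

/-! ### Folding the ends of a cobordism, and `2 [M, f] = 0` -/

namespace Literature.Topology.FourManifolds

universe u

section Fold

variable {n : ℕ} {M N P : Type u}
  [TopologicalSpace M] [ChartedSpace (EuclideanSpace ℝ (Fin n)) M]
  [TopologicalSpace N] [ChartedSpace (EuclideanSpace ℝ (Fin n)) N]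
  [TopologicalSpace P] [ChartedSpace (EuclideanSpace ℝ (Fin n)) P]

/-- **Folding the ends of a cobordism.**  A cobordism `W` from `M` to `N` with compact ends is
also a cobordism from `M ⊔ N` to the empty manifold `P` with the same total space: the incoming
end is `Sum.elim inl inr` (a smooth embedding by `IsSmoothEmbedding.sumElim`, the two ranges being
disjoint), the outgoing end is empty, and `range (inl ⊔ inr) = range inl ∪ range inr = ∂W`.
Milnor, *Lectures on the h-cobordism theorem* (1965), §1 (a smooth manifold triad `(W; V₀, V₁)`,
`∂W = V₀ ⊔ V₁`; the case `V₁ = ∅`). [cite: MilnorHCobordism1965, §1] -/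
theorem Cobordism.exists_fold [CompactSpace M] [CompactSpace N] [IsEmpty P]
    (c : Cobordism n M N) :
    ∃ (d : Cobordism n (M ⊕ N) P) (Φ : d.W ≃ₘ^∞⟮𝓡∂ (n + 1), 𝓡∂ (n + 1)⟯ c.W),
      ∀ x, Φ (d.inl x) = Sum.elim c.inl c.inr x :=
  ⟨{ W := c.W
     inl := Sum.elim c.inl c.inr
     inr := isEmptyElim
     isSmoothEmbedding_inl :=
       c.isSmoothEmbedding_inl.sumElim c.isSmoothEmbedding_inr c.disjoint_range
     isSmoothEmbedding_inr :=
       ⟨⟨PUnit, inferInstance, inferInstance, fun y => isEmptyElim y⟩, .of_subsingleton _⟩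
     disjoint_range := by simp [Set.range_eq_empty]
     range_inl_union_range_inr := by
       simp only [Set.Sum.elim_range, Set.range_eq_empty, union_empty]
       exact c.range_inl_union_range_inr },
    Diffeomorph.refl _ _ _, fun _ => rfl⟩

/-- Cobordant compact manifolds have a null-cobordant disjoint union: `M ∼ N` implies
`M ⊔ N ∼ ∅` (`Literature.Topology.FourManifolds.Cobordism.exists_fold`).  Milnor (1965), §1.
[cite: MilnorHCobordism1965, §1] -/
theorem IsCobordant.sum_isEmpty [CompactSpace M] [CompactSpace N] [IsEmpty P]
    (h : IsCobordant n M N) : IsCobordant n (M ⊕ N) P :=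
  h.elim fun c => (c.exists_fold (P := P)).elim fun d _ => ⟨d⟩

end Fold

namespace ClosedSingularManifold

variable {X : Type*} [TopologicalSpace X] {n : ℕ}

/-- The carrier of a closed singular manifold is second countable (a compact charted space over
the second-countable model `ℝⁿ`; Mathlib `ChartedSpace.secondCountable_of_sigmaCompact`).
[folklore] -/
theorem secondCountableTopology_M (s : ClosedSingularManifold.{u} X n) :
    SecondCountableTopology s.M :=
  ChartedSpace.secondCountable_of_sigmaCompact (EuclideanSpace ℝ (Fin n)) s.M

/-- **Every singular manifold has order two up to bordism** (discharge of the named fact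
`Literature.Topology.FourManifolds.ClosedSingularManifold.isBordant_sum_self_empty`): for a
closed singular `n`-manifold `s = (M, f)` on `X`, `(M ⊔ M, f ⊔ f)` is bordant to the empty
singular manifold, via the cylinder `M × [0, 1]` (`Literature.Topology.FourManifolds.cylinderCobordism`,
with its ends folded into one incoming end `M ⊔ M`, `Cobordism.exists_fold`) and the map
`f ∘ pr₁`, which restricts to `f` on both copies of `M`.  Milnor–Stasheff, *Characteristic
classes* (1974), §17, p. 199 ff. (every element of `𝔑ₙ(X)` has order `2`); Thom (1954), Ch. IV;
Conner–Floyd, *Differentiable Periodic Maps* (1964), §8. [cite: MilnorStasheff1974, §17] -/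
theorem isBordant_sum_self_empty_holds : isBordant_sum_self_empty.{u} (X := X) (n := n) := by
  intro s
  haveI : SecondCountableTopology s.M := s.secondCountableTopology_M
  obtain ⟨d, Φ, hΦ⟩ :=
    (cylinderCobordism n s.M).exists_fold (P := (empty.{u} X n).M)
  refine ⟨d, (⟨s.f, s.hf⟩ : C(s.M, X)).comp (Cylinder.proj.comp ⟨Φ, Φ.continuous⟩), ?_, ?_⟩
  · rintro (x | x)
    · simp only [ContinuousMap.comp_apply, ContinuousMap.coe_mk, sum_f, Sum.elim_inl]
      rw [hΦ]
      rfl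
    · simp only [ContinuousMap.comp_apply, ContinuousMap.coe_mk, sum_f, Sum.elim_inr]
      rw [hΦ]
      rfl
  · intro y
    exact y.elim

end ClosedSingularManifold

end Literature.Topology.FourManifolds
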